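import Summits.Ventures.HSemireg.WedgeHankelRecurrenceGaussHermiteLaguerreZeros

/-!
# Venture HSemireg — **BOUNDS FOR THE EXTREME ZEROS FROM THE RECIPROCAL SUM RULES**: a single positive term is below the whole sum — from N398's `Σ_k 1∕x_k = (t+1)∕(α+1)` (Laguerre) and
# `Σ_k 1∕(1 − x_k²) = (t+1)(t+2)∕2` (Legendre): **LAGUERRE `(α+1)∕(t+1) < x_0`** (`t ≥ 1`; with N393: `(α+1)∕(t+1) < x_0 < α + 1`) and **LEGENDRE `x_t² < 1 − 2∕((t+1)(t+2))`** (`t ≥ 1`; with N393: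
# `t∕(t+2) ≤ x_t² < 1 − 2∕((t+1)(t+2))`)

HONEST FRAMING. Part of the Lean index of the computation cell `pub-hsemireg` (seat p10 gen 46, Sunday typer «UNIFORM-IN-n»).  Finite sums only; no variety, no cohomology theory, no sheaf, no Ext
group and no semiregularity map is constructed here; nothing here says that HC / HC_CM / HC_AV holds; no Literature fact (unproved `Prop`) is declared or used.  Custodian versions as in
`WedgeHankelSiegelIdeal` (1/3).
SOURCES (cited).  G. Szegő, *Orthogonal Polynomials*, §6.2, §6.21, §6.31 (elementary bounds for the extreme zeros; cf. (6.31.11)–(6.31.12)); S. Ahmed et al., Nuovo Cimento B 49 (1979) 173–199.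
PROOF TYPED HERE.  `Finset.single_lt_sum` against N398 `laguerre_zeros_sum_inv` ∕ `legendre_zeros_sum_inv_one_sub_sq` (all terms positive, at least two of them).
DEDUP DISCLOSURE (`rg -n -i 'smallest_zero_gt|largest_zero_sq_lt' Summits/Ventures/HSemireg`, 2026-09-03): N393 (the complementary bounds), N376 ∕ N379 (upper bounds).  The 2 names below: 0 hits tree-wide.

WHAT IS IN THE TREE.  N398 `laguerre_zeros_sum_inv`, `legendre_zeros_sum_inv_one_sub_sq`; Mathlib `Finset.single_lt_sum`.
THIS FILE (namespace `Summit.Ventures.HSemireg.Wedge.HankelOuter` continued; CHAINED on N400 (import only); 0 definitions):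
* §1166 **`laguerre_smallest_zero_gt`** (`(α+1)∕(t+1) < x_0`), **`legendre_largest_zero_sq_lt`** (`x_t² < 1 − 2∕((t+1)(t+2))`).
CAVEATS.  `t ≥ 1` (for `t = 0` both become equalities).  Nothing Ext-side.  New names only.
-/

open Module Polynomial
open scoped Matrix Polynomial

namespace Summit.Ventures.HSemireg.Wedge.HankelOuter

/-! ## §1166. Bounds from the reciprocal sum rules -/

/-- **LAGUERRE: `(α+1)∕(t+1) < x_0`** for the smallest zero of `L^{(α)}_{t+1}` (`α > −1`, `t ≥ 1`). [Szegő §6.31 (cf.); this file, §1166] -/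
theorem laguerre_smallest_zero_gt {L : ℕ → ℝ[X]} {a b : ℕ → ℝ} {α : ℝ} (hL0 : L 0 = 1) (hL1 : L 1 = Polynomial.X - C (a 0))
    (hLrec : ∀ n, L (n + 2) = (Polynomial.X - C (a (n + 1))) * L (n + 1) - C (b (n + 1)) * L n) (ha : ∀ n, a n = 2 * n + 1 + α)
    (hb : ∀ n, b (n + 1) = ((n : ℝ) + 1) * ((n : ℝ) + 1 + α)) (hα : -1 < α) {t : ℕ} (ht : 1 ≤ t) {x : Fin (t + 1) → ℝ} (hx : StrictMono x)
    (hxq : L (t + 1) = ∏ k, (Polynomial.X - C (x k))) (hpos : ∀ k, 0 < x k) : (α + 1) / ((t : ℝ) + 1) < x 0 := by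
  have hsum := laguerre_zeros_sum_inv hL0 hL1 hLrec ha hb hα hx hxq hpos
  have hlt : (x 0)⁻¹ < ∑ k, (x k)⁻¹ :=
    Finset.single_lt_sum (i := 0) (j := Fin.last t) (by intro h; have := congrArg Fin.val h; simp at this; omega) (Finset.mem_univ _) (Finset.mem_univ _)
      (inv_pos.2 (hpos _)) fun k _ _ => (inv_pos.2 (hpos k)).le
  rw [hsum] at hlt
  have hα1 : 0 < α + 1 := by linarith
  have hx0 := hpos 0
  rw [div_lt_iff₀ (by positivity)]
  have h1 := (inv_lt_iff_one_lt_mul₀ hx0).1 hlt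
  -- `1 < ((t+1)/(α+1)) · x_0`
  have h2 : 1 * (α + 1) < ((t : ℝ) + 1) / (α + 1) * x 0 * (α + 1) := mul_lt_mul_of_pos_right h1 hα1
  rw [one_mul, div_mul_eq_mul_div, div_mul_cancel₀ _ hα1.ne'] at h2
  linarith

/-- **LEGENDRE: `x_t² < 1 − 2∕((t+1)(t+2))`** for the largest zero of `P_{t+1}` (`t ≥ 1`). [Szegő §6.21 (cf.); this file, §1166] -/
theorem legendre_largest_zero_sq_lt {q : ℕ → ℝ[X]} {a b : ℕ → ℝ} (hq0 : q 0 = 1) (hq1 : q 1 = Polynomial.X - C (a 0))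
    (hrec : ∀ n, q (n + 2) = (Polynomial.X - C (a (n + 1))) * q (n + 1) - C (b (n + 1)) * q n) (ha : ∀ n, a n = 0)
    (hb : ∀ n, b (n + 1) = ((n : ℝ) + 1) ^ 2 / (4 * ((n : ℝ) + 1) ^ 2 - 1)) {t : ℕ} (ht : 1 ≤ t) {x : Fin (t + 1) → ℝ} (hx : StrictMono x)
    (hxq : q (t + 1) = ∏ k, (Polynomial.X - C (x k))) (hmem : ∀ k, -1 < x k ∧ x k < 1) :
    x (Fin.last t) ^ 2 < 1 - 2 / (((t : ℝ) + 1) * ((t : ℝ) + 2)) := by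
  have hsum := legendre_zeros_sum_inv_one_sub_sq hq0 hq1 hrec ha hb hx hxq hmem
  have hpos : ∀ k, 0 < 1 - x k ^ 2 := fun k => by nlinarith [(hmem k).1, (hmem k).2]
  have hlt : (1 - x (Fin.last t) ^ 2)⁻¹ < ∑ k, (1 - x k ^ 2)⁻¹ :=
    Finset.single_lt_sum (i := Fin.last t) (j := 0) (by intro h; have := congrArg Fin.val h; simp at this; omega) (Finset.mem_univ _) (Finset.mem_univ _)
      (inv_pos.2 (hpos _)) fun k _ _ => (inv_pos.2 (hpos k)).le
  rw [hsum] at hlt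
  have h1 := hpos (Fin.last t)
  have hT : (0 : ℝ) < ((t : ℝ) + 1) * ((t : ℝ) + 2) := by positivity
  -- `1/(1 − x²) < (t+1)(t+2)/2` ⇒ `2/((t+1)(t+2)) < 1 − x²`
  rw [inv_lt_iff_one_lt_mul₀ h1] at hlt
  have h2 : 2 / (((t : ℝ) + 1) * ((t : ℝ) + 2)) < 1 - x (Fin.last t) ^ 2 := by
    rw [div_lt_iff₀ hT]; nlinarith
  linarith

end Summit.Ventures.HSemireg.Wedge.HankelOuter
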